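import Summits.BirchSwinnertonDyer.BirchSwinnertonDyer.Theorems.KolyvaginRankRigidityAtTwoRegularRefillAtRegularStep
import Summits.BirchSwinnertonDyer.BirchSwinnertonDyer.Theorems.KolyvaginRankRigidityAtTwoRegularRefillLawGeneralHf
import HarnessLib

/-!
# Crux U1 `KolyvaginBoundedDefectAtTwo` (stmt-BirchSwinnertonDyer-28083), LINE 17 `regular_core_rigidity` v3,
# stub S1b `stub_nearCoreExistenceAtTwo` — ONE STEP OF THE WALK, LOCAL CONSEQUENCES II: the refill law for a
# cutter of NON-EXACT local order `2^(k−j)`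

Width seat `bsd-line-krr2-p2` g14 (ONE READER on S1b); `--supports stmt-BirchSwinnertonDyer-28083` (helper). THEOREMS
ONLY; nothing here proves S1b, U1, a rung or BSD. BSD is NOT proved.

## Setting (g13's, `…RegularRefillAtRegularStep`)
`𝓛 = 𝓕(c) = selmerF W 2^k 𝒯 (placesDividing K c)`, `c` a square-free Kolyvagin conductor (indices `≥ k+1`), a place
`v ∣ ℓ ∣ c` REGULAR at level `2^k`; `S = H¹_{𝓛[v ↦ Kum_v]}`, `S' = H¹_{𝓛}`, `A = loc_v(S)`, `X = loc_v(H¹_{𝓛[v ↦ ⊤]})`.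
* abstract bricks: `two_pow_nsmul_mem_zmultiples_of_addOrderOf` (in `ℤg` of order `2^k` an element of order `2^(k−j)`
  generates `ℤ(2^j g)`), `natCard_zmultiples_inf_ker_le` (`#(ℤc ∩ ker N) ≤ N`), `natCard_inf_ker_le_of_eigenlines`
  (`#(H ∩ ker N) ≤ 2N²` for a group with an involution whose eigen-subgroups are cyclic);
* `natCard_kummer_inf_ker_le` — `#(Kum_v ∩ ker N) ≤ 2N²` at a regular place (`kummer_regular_eigen_at_two`, p677251);
* `hcyc_upTo_of_eigenclass` — an `s`-eigenclass `z ∈ S` with `addOrderOf (loc_v z) = 2^(k−j)` gives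
  `2^j Kum_v ⊆ X + ℤe₀`;
* **`lozenge_refill_of_regular_eigenclass_upTo`** — THE REFILL LAW FOR A CUTTER OF LOCAL ORDER `2^(k−j)`:
  `#S · #Kum_v ≤ 2^(4j+4) · #A² · #S'` (`lozenge_refill_of_cyclic_upTo_f`, p685157); `j = 0` is g13's p678125 up to
  the constant. In the walk of S1b the cutters are frame classes of order `≥ 2^(k−c)` (so `j ≤ c + 1`), and the
  constant stays independent of `k`.
References (locators only; no cited FACT is declared): [cite: MazurRubin2004, Prop. 1.3.2, §2.4 (H.2), §4.1]
[cite: Jetchev2008, §3.2 (2), Lemma 5.2, proof of Prop. 5.3] [cite: Howard2004HeegnerKolyvagin, Thm. 2.1.11]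
[cite: GrossLMS1991, §3 (3.3)].
Design: no definitions; `K : Type`; axioms `propext`, `Classical.choice`, `Quot.sound`.
-/

set_option autoImplicit false
-- the Theorems namespace of this sub repeats the summit name by design (D-0017 nested layout)
set_option linter.dupNamespace false

noncomputable section

open scoped Classical
open Function NumberField IsDedekindDomain WeierstrassCurve Field
open Literature.NumberTheory.EllipticCurves Literature.NumberTheory.EllipticCurves.Jetchev2008
open Literature.NumberTheory.GaloisRepresentations Literature.NumberTheory.GaloisCohomology
open Literature.NumberTheory.GaloisRepresentations.DiscreteGaloisModule (localTatePairingZMod tateDual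
  transverseSubgroup SelmerStructure)
open Literature.NumberTheory.Automorphic
open Summit.BirchSwinnertonDyer.Rank1Residual
open Summit.BirchSwinnertonDyer.Rank1Residual.JET.RingClassTransverse
open Summit.BirchSwinnertonDyer.Rank1Residual.JET.SelmerVocabulary
open Summit.BirchSwinnertonDyer.Rank1Residual.X11b.Relaxation (invWeilPairing invWeilPairing_apply
  invWeilPairing_eq_zero_of_mem)
open Summit.BirchSwinnertonDyer.BirchSwinnertonDyer.Theorems.KolyvaginLowerBoundAtTwo
open Summit.BirchSwinnertonDyer.Rank1Residual.JET.Section6 (card_eq_card_inf_ker_mul_card_map card_map_mul_card_map_le)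

namespace Summit.BirchSwinnertonDyer.BirchSwinnertonDyer.Theorems.KolyvaginAtTwo.RegularRefill

variable {K : Type} [Field K] [NumberField K] (W : WeierstrassCurve ℚ) [W.IsElliptic] [W.IsGloballyMinimal]
  (k : ℕ)
  (e : geomTorsion (W.baseChange K) ((2 ^ k : ℕ) : ℤ) → geomTorsion (W.baseChange K) ((2 ^ k : ℕ) : ℤ) →
    AlgebraicClosure K)
  (hμ : ∀ S T, e S T ^ (2 ^ k) = 1)
  (hadd₁ : ∀ S₁ S₂ T, e (S₁ + S₂) T = e S₁ T * e S₂ T)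
  (hadd₂ : ∀ S T₁ T₂, e S (T₁ + T₂) = e S T₁ * e S T₂)
  (hgal : ∀ (g : absoluteGaloisGroup K) (S T : geomTorsion (W.baseChange K) ((2 ^ k : ℕ) : ℤ)),
    g • e S T = e (g • S) (g • T))
  (halt : ∀ T, e T T = 1) (hnondeg : ∀ T, (∀ S, e S T = 1) → T = 0)
  (inv : LocalInvariants K (2 ^ k))
  (hK : IsImaginaryQuadratic K) (hD : NumberField.discr K < -4) (ι : K →+* ℂ)
  [∀ j : ℕ, NumberField (ringClassField K ι j)] (hk : 1 ≤ k)
  (c : ℕ) (hc : Squarefree c)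
  (hkol : ∀ ℓ ∈ c.primeFactors, Zhang2014.IsKolyvaginPrime (W.conductorNorm ℤ) W K 2 ℓ)
  (hkM : ∀ ℓ ∈ c.primeFactors, k + 1 ≤ Zhang2014.kolyvaginIndex W 2 ℓ)
  (𝒯 : SelmerStructure ((W.baseChange K).torsionGaloisModule ((2 ^ k : ℕ) : ℤ)))
  (h𝒯 : ∀ v : HeightOneSpectrum (𝓞 K), 𝒯 (Sum.inr v) =
    ⨅ ℓ ∈ c.primeFactors.filter (fun ℓ : ℕ ↦ ((ℓ : ℕ) : 𝓞 K) ∈ v.asIdeal),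
      ⨅ (w' : HeightOneSpectrum (𝓞 (ringClassField K ι ℓ))) (_ : w'.asIdeal.LiesOver v.asIdeal),
        letI := (adicCompletionOfLiesOver K (ringClassField K ι ℓ) v w').toAlgebra
        transverseSubgroup (GaloisRep.toLocal v ((W.baseChange K).torsionGaloisModule ((2 ^ k : ℕ) : ℤ)))
          (w'.adicCompletion (ringClassField K ι ℓ)))
  (hperf : inv.IsPerfect) (hvan : inv.SumLocalTermEqZero) (hcomp : inv.SelmerComplement)
  {ℓ : ℕ} (hℓc : ℓ ∈ c.primeFactors)
  (hreg : ∃ (v₁ : HeightOneSpectrum (𝓞 ℚ)) (𝔓₁ : Ideal (absIntegers (𝓞 ℚ) ℚ)) (h : absoluteGaloisGroup ℚ),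
    (ℓ : 𝓞 ℚ) ∈ v₁.asIdeal ∧ 𝔓₁ ∈ v₁.primesAbove ∧ IsArithFrobAt (𝓞 ℚ) h 𝔓₁ ∧
    (∀ X : geomTorsion W ((2 ^ k : ℕ) : ℤ), h • h • X = X) ∧
    ∃ P : geomTorsion W ((2 ^ k : ℕ) : ℤ), (2 : ℤ) ^ (k - 1) • (P + h • P) ≠ 0)
  (v : HeightOneSpectrum (𝓞 K)) (hv : (ℓ : 𝓞 K) ∈ v.asIdeal)
  {τ : K ≃ₐ[ℚ] K} (hτ1 : τ ≠ 1) (hfix : τ • v = v) {s : ℤ} (hs : s = 1 ∨ s = -1)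

/-! ### §2 Abstract bricks: generators of a cyclic `2`-group up to `2^j`; torsion of a two-line group -/

section Abstract

variable {A : Type*} [AddCommGroup A]

/-- In a cyclic group `ℤg` of order `2^k`, an element `y ∈ ℤg` of order `2^(k−j)` (`j ≤ k`) has `2^j g ∈ ℤy`
(indeed `ℤy = ℤ(2^j g)`). [folklore] -/
theorem two_pow_nsmul_mem_zmultiples_of_addOrderOf {g y : A} {m j : ℕ} (hg : addOrderOf g = 2 ^ m)
    (hy : y ∈ AddSubgroup.zmultiples g) (hjm : j ≤ m) (hyord : addOrderOf y = 2 ^ (m - j)) :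
    (2 ^ j) • g ∈ AddSubgroup.zmultiples y := by
  obtain ⟨t, rfl⟩ := AddSubgroup.mem_zmultiples_iff.mp hy
  -- `2^k ∣ 2^(k-j) t`, hence `2^j ∣ t`
  have h1 : (((2 ^ (m - j) : ℕ) : ℤ) * t) • g = 0 := by
    rw [mul_smul, natCast_zsmul, ← hyord]
    exact addOrderOf_nsmul_eq_zero (t • g)
  have h2 : ((addOrderOf g : ℕ) : ℤ) ∣ ((2 ^ (m - j) : ℕ) : ℤ) * t := addOrderOf_dvd_iff_zsmul_eq_zero.mpr h1
  have hpow : ((2 ^ m : ℕ) : ℤ) = ((2 ^ (m - j) : ℕ) : ℤ) * ((2 ^ j : ℕ) : ℤ) := by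
    rw [← Nat.cast_mul, ← pow_add, Nat.sub_add_cancel hjm]
  rw [hg, hpow] at h2
  obtain ⟨u, hu⟩ : ((2 ^ j : ℕ) : ℤ) ∣ t :=
    (mul_dvd_mul_iff_left (by positivity : ((2 ^ (m - j) : ℕ) : ℤ) ≠ 0)).mp h2
  -- `ℤ(t g) ≤ ℤ(2^j g)` with `#ℤ(2^j g) ≤ 2^(k-j) = #ℤ(t g)`: equality
  have hle : AddSubgroup.zmultiples (t • g) ≤ AddSubgroup.zmultiples ((2 ^ j) • g) := by
    rw [AddSubgroup.zmultiples_le, hu, mul_comm, mul_smul, natCast_zsmul]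
    exact AddSubgroup.zsmul_mem _ (AddSubgroup.mem_zmultiples _) u
  have hdvd : addOrderOf ((2 ^ j) • g) ∣ 2 ^ (m - j) := by
    apply addOrderOf_dvd_of_nsmul_eq_zero
    rw [← mul_nsmul', ← pow_add, Nat.sub_add_cancel hjm, ← hg]
    exact addOrderOf_nsmul_eq_zero g
  haveI : Finite (AddSubgroup.zmultiples ((2 ^ j) • g)) := by
    apply Nat.finite_of_card_ne_zero
    rw [Nat.card_zmultiples]
    intro h0
    rw [h0] at hdvd
    exact pow_ne_zero _ two_ne_zero (Nat.eq_zero_of_zero_dvd hdvd)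
  have heq : AddSubgroup.zmultiples (t • g) = AddSubgroup.zmultiples ((2 ^ j) • g) :=
    AddSubgroup.eq_of_le_of_card_ge hle (by
      rw [Nat.card_zmultiples, Nat.card_zmultiples, hyord]
      exact Nat.le_of_dvd (by positivity) hdvd)
  rw [heq]
  exact AddSubgroup.mem_zmultiples _

/-- **`#(ℤc ∩ ker N) ≤ N`**: a cyclic group has at most `N` elements killed by `N > 0` (its `N`-torsion is cyclic,
generated by an element of order dividing `N`). [folklore] -/
theorem natCard_zmultiples_inf_ker_le (g : A) (N : ℕ) (hN : 0 < N) :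
    Nat.card ↥(AddSubgroup.zmultiples g ⊓ (nsmulAddMonoidHom N : A →+ A).ker) ≤ N := by
  obtain ⟨n, hn⟩ := (AddSubgroup.le_zmultiples_iff g _).mp
    (inf_le_left : AddSubgroup.zmultiples g ⊓ (nsmulAddMonoidHom N : A →+ A).ker ≤ AddSubgroup.zmultiples g)
  have hmem : n • g ∈ AddSubgroup.zmultiples g ⊓ (nsmulAddMonoidHom N : A →+ A).ker := by
    rw [hn]; exact AddSubgroup.mem_zmultiples _
  have hN0 : N • (n • g) = 0 := (AddMonoidHom.mem_ker).mp (AddSubgroup.mem_inf.mp hmem).2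
  rw [hn, Nat.card_zmultiples]
  exact Nat.le_of_dvd hN (addOrderOf_dvd_of_nsmul_eq_zero hN0)

/-- **Torsion of a two-line group: `#(H ∩ ker N) ≤ 2N²`.** If an endomorphism `σ` preserves `H`, is an involution on
`H`, and the `σ`-fixed resp. `σ`-anti-fixed elements of `H` lie in cyclic groups `ℤcp` resp. `ℤcm`, then
`x ↦ (x + σx, x − σx)` maps `H ∩ ker N` to `(ℤcp ∩ ker N) × (ℤcm ∩ ker N)` with kernel inside `ℤcp ∩ ker 2`.
(For `Kum_v ≅ E[2^k]` at a regular Kolyvagin place with `σ = τ_*`.) [folklore] -/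
theorem natCard_inf_ker_le_of_eigenlines [Finite A] (H : AddSubgroup A) (σ : A →+ A)
    (hσH : ∀ x ∈ H, σ x ∈ H) {cp cm : A}
    (hp : ∀ x ∈ H, σ x = x → x ∈ AddSubgroup.zmultiples cp)
    (hm : ∀ x ∈ H, σ x = -x → x ∈ AddSubgroup.zmultiples cm)
    (hσσ : ∀ x ∈ H, σ (σ x) = x) (N : ℕ) (hN : 0 < N) :
    Nat.card ↥(H ⊓ (nsmulAddMonoidHom N : A →+ A).ker) ≤ 2 * N * N := by
  set S := H ⊓ (nsmulAddMonoidHom N : A →+ A).ker with hSdef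
  set φ : A →+ A × A := (AddMonoidHom.id A + σ).prod (AddMonoidHom.id A - σ) with hφ
  have hφ1 : ∀ x, (φ x).1 = x + σ x := fun x ↦ rfl
  have hφ2 : ∀ x, (φ x).2 = x - σ x := fun x ↦ rfl
  have hS : Nat.card S = Nat.card ↥(S ⊓ φ.ker) * Nat.card ↥(S.map φ) := card_eq_card_inf_ker_mul_card_map φ S
  -- the kernel of `φ` on `S` lies in `ℤcp ∩ ker 2`
  have hker : S ⊓ φ.ker ≤ AddSubgroup.zmultiples cp ⊓ (nsmulAddMonoidHom 2 : A →+ A).ker := by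
    intro x hx
    obtain ⟨hxS, hxk⟩ := AddSubgroup.mem_inf.mp hx
    have hxH : x ∈ H := (AddSubgroup.mem_inf.mp hxS).1
    have h0 : φ x = 0 := (AddMonoidHom.mem_ker).mp hxk
    have h1 : x + σ x = 0 := by rw [← hφ1, h0, Prod.fst_zero]
    have h2 : x - σ x = 0 := by rw [← hφ2, h0, Prod.snd_zero]
    have hσx : σ x = x := (sub_eq_zero.mp h2).symm
    refine AddSubgroup.mem_inf.mpr ⟨hp x hxH hσx, (AddMonoidHom.mem_ker).mpr ?_⟩
    calc (nsmulAddMonoidHom 2 : A →+ A) x = x + σ x := by rw [nsmulAddMonoidHom_apply, two_nsmul, hσx]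
      _ = 0 := h1
  -- the image of `S` lies in `(ℤcp ∩ ker N) × (ℤcm ∩ ker N)`
  have himg : S.map φ ≤ (AddSubgroup.zmultiples cp ⊓ (nsmulAddMonoidHom N : A →+ A).ker).prod
      (AddSubgroup.zmultiples cm ⊓ (nsmulAddMonoidHom N : A →+ A).ker) := by
    rintro _ ⟨x, hx, rfl⟩
    obtain ⟨hxH, hxN⟩ := AddSubgroup.mem_inf.mp hx
    have hxN' : N • x = 0 := (AddMonoidHom.mem_ker).mp hxN
    have hσxH : σ x ∈ H := hσH x hxH
    rw [AddSubgroup.mem_prod, hφ1, hφ2]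
    refine ⟨AddSubgroup.mem_inf.mpr ⟨hp _ (H.add_mem hxH hσxH) ?_, (AddMonoidHom.mem_ker).mpr ?_⟩,
      AddSubgroup.mem_inf.mpr ⟨hm _ (H.sub_mem hxH hσxH) ?_, (AddMonoidHom.mem_ker).mpr ?_⟩⟩
    · rw [map_add, hσσ x hxH, add_comm]
    · rw [nsmulAddMonoidHom_apply, nsmul_add, ← map_nsmul, hxN', map_zero, add_zero]
    · rw [map_sub, hσσ x hxH, neg_sub]
    · rw [nsmulAddMonoidHom_apply, nsmul_sub, ← map_nsmul, hxN', map_zero, sub_zero]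
  have hcp2 : Nat.card ↥(AddSubgroup.zmultiples cp ⊓ (nsmulAddMonoidHom 2 : A →+ A).ker) ≤ 2 :=
    natCard_zmultiples_inf_ker_le cp 2 two_pos
  have hprod : Nat.card ↥((AddSubgroup.zmultiples cp ⊓ (nsmulAddMonoidHom N : A →+ A).ker).prod
      (AddSubgroup.zmultiples cm ⊓ (nsmulAddMonoidHom N : A →+ A).ker)) ≤ N * N := by
    rw [Nat.card_congr (AddSubgroup.prodEquiv _ _).toEquiv, Nat.card_prod]
    exact Nat.mul_le_mul (natCard_zmultiples_inf_ker_le cp N hN) (natCard_zmultiples_inf_ker_le cm N hN)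
  calc Nat.card S = Nat.card ↥(S ⊓ φ.ker) * Nat.card ↥(S.map φ) := hS
    _ ≤ 2 * (N * N) :=
        Nat.mul_le_mul ((AddSubgroup.card_le_of_le hker).trans hcp2) ((AddSubgroup.card_le_of_le himg).trans hprod)
    _ = 2 * N * N := (mul_assoc _ _ _).symm

end Abstract

/-! ### §3 In situ: torsion of `Kum_v`, co-cyclicity up to `2^j`, and the refill law for a cutter of local order
`2^(k−j)` -/

include hK hk hkol hkM hℓc hreg hv hτ1 hfix in
/-- **`#(Kum_v ∩ ker N) ≤ 2N²` at a regular Kolyvagin place** (level `2^k`, index `≥ k+1`): `Kum_v` is preserved by the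
involution `τ_* = conjActPlace`, and its `(±)`-eigen-subgroups are the cyclic regular eigen-lines `ℤc_±`
(`kummer_regular_eigen_at_two`). [cite: MazurRubin2004, §2.4 (H.2), Lemma 1.2.4] [cite: Jetchev2008, §3.2 (2)] -/
theorem natCard_kummer_inf_ker_le [NeZero (2 ^ k)] [Finite (geomTorsion (W.baseChange K) ((2 ^ k : ℕ) : ℤ))]
    (N : ℕ) (hN : 0 < N) :
    Nat.card ↥((W.baseChange K).kummerSelmerStructure ((2 ^ k : ℕ) : ℤ) (Sum.inr v : Place K) ⊓
      (nsmulAddMonoidHom N : _ →+ galoisCohomology ((((W.baseChange K).torsionGaloisModule ((2 ^ k : ℕ) : ℤ))).toLocal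
        (Sum.inr v : Place K)) 1).ker) ≤ 2 * N * N := by
  haveI : Finite (galoisCohomology ((((W.baseChange K).torsionGaloisModule ((2 ^ k : ℕ) : ℤ))).toLocal
      (Sum.inr v : Place K)) 1) := finite_galoisCohomology_one_toLocal _ v
  have hℓ := hkol ℓ hℓc
  have hkℓ : k ≤ Zhang2014.kolyvaginIndex W 2 ℓ := Nat.le_of_succ_le (hkM ℓ hℓc)
  obtain ⟨⟨cp, -, -, hlinep⟩, -⟩ :=
    kummer_regular_eigen_at_two W K hK hk hℓ hkℓ hreg v hv hτ1 hfix (s := 1) (Or.inl rfl)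
  obtain ⟨⟨cm, -, -, hlinem⟩, -⟩ :=
    kummer_regular_eigen_at_two W K hK hk hℓ hkℓ hreg v hv hτ1 hfix (s := -1) (Or.inr rfl)
  have hττ : τ * τ = 1 := by
    haveI : Algebra.IsQuadraticExtension ℚ K := ⟨hK.1⟩
    have hcard : Nat.card (K ≃ₐ[ℚ] K) = 2 := by rw [IsGalois.card_aut_eq_finrank, hK.1]
    haveI : Finite (K ≃ₐ[ℚ] K) := Nat.finite_of_card_ne_zero (by rw [hcard]; decide)
    have h : τ ^ Nat.card (K ≃ₐ[ℚ] K) = 1 := pow_card_eq_one'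
    rw [hcard, pow_two] at h
    exact h
  refine natCard_inf_ker_le_of_eigenlines _ (conjActPlace W τ ((2 ^ k : ℕ) : ℤ) hfix)
    (fun x hx ↦ conjActPlace_mem_kummerSelmerStructure W τ ((2 ^ k : ℕ) : ℤ) hfix hx)
    (fun x hx hσx ↦ (hlinep x).mp (AddSubgroup.mem_inf.mpr ⟨hx, (AddMonoidHom.mem_ker).mpr ?_⟩))
    (fun x hx hσx ↦ (hlinem x).mp (AddSubgroup.mem_inf.mpr ⟨hx, (AddMonoidHom.mem_ker).mpr ?_⟩))
    (fun x _ ↦ conjActPlace_conjActPlace W τ ((2 ^ k : ℕ) : ℤ) hττ hfix hfix x) N hN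
  · rw [AddMonoidHom.sub_apply, AddMonoidHom.smul_apply, AddMonoidHom.id_apply, hσx, one_zsmul, sub_self]
  · rw [AddMonoidHom.sub_apply, AddMonoidHom.smul_apply, AddMonoidHom.id_apply, hσx, neg_one_zsmul, sub_self]

include hK hk hkol hkM hℓc hreg hv hτ1 hfix hs in
/-- **Co-cyclicity of the cut UP TO `2^j` from an eigenclass of local order `2^(k−j)`** — hypothesis `hcyc` of the
general refill law (`lozenge_refill_of_cyclic_upTo_f`): an `s`-eigenclass `z` of the previous vertex with
`addOrderOf (loc_v z) = 2^(k−j)` gives `2^j Kum_v ⊆ X + ℤe₀` (`X = loc_v(H¹_{𝓛[v ↦ ⊤]})`): `loc_v z` lies in the cyclic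
`s`-eigen-line `ℤc_s` and has order `2^(k−j)`, so `2^j c_s ∈ ℤ(loc_v z) ⊆ X`, while `Kum_v = ℤc_s + ℤe₀`.
[cite: MazurRubin2004, §2.4 (H.2), §4.1] [cite: GrossLMS1991, §3 (3.3)] -/
theorem hcyc_upTo_of_eigenclass {j : ℕ} (hjk : j ≤ k)
    {z : galoisCohomology ((W.baseChange K).torsionGaloisModule ((2 ^ k : ℕ) : ℤ)) 1}
    (hz : z ∈ SelmerStructure.selmerGroup (Function.update (selmerF W ((2 ^ k : ℕ) : ℤ) 𝒯 (placesDividing K c))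
      (Sum.inr v : Place K) ((W.baseChange K).kummerSelmerStructure ((2 ^ k : ℕ) : ℤ) (Sum.inr v : Place K)) :
      SelmerStructure ((W.baseChange K).torsionGaloisModule ((2 ^ k : ℕ) : ℤ))))
    (hzτ : conjAct W τ ((2 ^ k : ℕ) : ℤ) z = s • z)
    (hzord : addOrderOf (galoisCohomology.localization ((W.baseChange K).torsionGaloisModule ((2 ^ k : ℕ) : ℤ))
      (Sum.inr v : Place K) 1 z) = 2 ^ (k - j)) :
    ∃ e₀ ∈ (W.baseChange K).kummerSelmerStructure ((2 ^ k : ℕ) : ℤ) (Sum.inr v : Place K),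
      ∀ f ∈ (W.baseChange K).kummerSelmerStructure ((2 ^ k : ℕ) : ℤ) (Sum.inr v : Place K), ∃ m : ℤ,
        (2 ^ j) • f - m • e₀ ∈ (SelmerStructure.selmerGroup (Function.update (selmerF W ((2 ^ k : ℕ) : ℤ) 𝒯
            (placesDividing K c)) (Sum.inr v : Place K) ⊤ :
              SelmerStructure ((W.baseChange K).torsionGaloisModule ((2 ^ k : ℕ) : ℤ)))).map
          (galoisCohomology.localization ((W.baseChange K).torsionGaloisModule ((2 ^ k : ℕ) : ℤ))
            (Sum.inr v : Place K) 1) := by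
  have hℓ := hkol ℓ hℓc
  have hkℓ : k ≤ Zhang2014.kolyvaginIndex W 2 ℓ := Nat.le_of_succ_le (hkM ℓ hℓc)
  obtain ⟨⟨cs, -, hcsord, hline⟩, e₀, he₀, hco⟩ := kummer_regular_eigen_at_two W K hK hk hℓ hkℓ hreg v hv hτ1 hfix hs
  set loc := galoisCohomology.localization ((W.baseChange K).torsionGaloisModule ((2 ^ k : ℕ) : ℤ))
    (Sum.inr v : Place K) 1 with hloc
  have hz' := hz
  rw [selmerGroup_update_eq_inf_comap W k _ v] at hz'
  obtain ⟨hzRel, hzKum⟩ := AddSubgroup.mem_inf.mp hz'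
  have hzKum' : loc z ∈ (W.baseChange K).kummerSelmerStructure ((2 ^ k : ℕ) : ℤ) (Sum.inr v : Place K) :=
    AddSubgroup.mem_comap.mp hzKum
  have hzeig : loc z ∈ (W.baseChange K).kummerSelmerStructure ((2 ^ k : ℕ) : ℤ) (Sum.inr v) ⊓
      (conjActPlace W τ ((2 ^ k : ℕ) : ℤ) hfix - s • AddMonoidHom.id _).ker := by
    refine AddSubgroup.mem_inf.mpr ⟨hzKum', (AddMonoidHom.mem_ker).mpr ?_⟩
    rw [AddMonoidHom.sub_apply, AddMonoidHom.smul_apply, AddMonoidHom.id_apply, sub_eq_zero, hloc,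
      conjActPlace_localization, hzτ, map_zsmul]
  have hgen : (2 ^ j) • cs ∈ AddSubgroup.zmultiples (loc z) :=
    two_pow_nsmul_mem_zmultiples_of_addOrderOf hcsord ((hline _).mp hzeig) hjk hzord
  obtain ⟨u, hu⟩ := AddSubgroup.mem_zmultiples_iff.mp hgen
  have hzX : loc z ∈ (SelmerStructure.selmerGroup (Function.update (selmerF W ((2 ^ k : ℕ) : ℤ) 𝒯
      (placesDividing K c)) (Sum.inr v : Place K) ⊤ :
        SelmerStructure ((W.baseChange K).torsionGaloisModule ((2 ^ k : ℕ) : ℤ)))).map loc :=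
    AddSubgroup.mem_map.mpr ⟨z, hzRel, rfl⟩
  refine ⟨e₀, he₀, fun f hf ↦ ?_⟩
  obtain ⟨m, hm⟩ := hco f hf
  obtain ⟨t, ht⟩ := AddSubgroup.mem_zmultiples_iff.mp ((hline _).mp hm)
  refine ⟨((2 ^ j : ℕ) : ℤ) * m, ?_⟩
  have key : (2 ^ j) • f - (((2 ^ j : ℕ) : ℤ) * m) • e₀ = (t * u) • loc z := by
    calc (2 ^ j) • f - (((2 ^ j : ℕ) : ℤ) * m) • e₀
        = (2 ^ j) • (f - m • e₀) := by rw [nsmul_sub, mul_smul, natCast_zsmul]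
      _ = (2 ^ j) • (t • cs) := by rw [ht]
      _ = t • ((2 ^ j) • cs) := smul_comm _ _ _
      _ = (t * u) • loc z := by rw [← hu, smul_smul]
  rw [key]
  exact AddSubgroup.zsmul_mem _ hzX (t * u)

include hμ hadd₁ hadd₂ hgal hK hD hk hc hkol hkM h𝒯 halt hnondeg hperf hvan hcomp hℓc hreg hv hτ1 hfix hs in
/-- **THE REFILL LAW AT A REGULAR STEP FOR A CUTTER OF LOCAL ORDER `2^(k−j)`** (`S = H¹_{𝓛[v ↦ Kum_v]}` the previous
vertex, `S' = H¹_{𝓛}` the new one, `A = loc_v(S)`): an `s`-eigenclass `z ∈ S` with `addOrderOf (loc_v z) = 2^(k−j)`,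
`j ≤ k`, gives **`#S · #Kum_v ≤ 2^(4j+4) · #A² · #S'`** — the general lozenge law `lozenge_refill_of_cyclic_upTo_f`
(p685157) with co-cyclicity up to `2^j` (`hcyc_upTo_of_eigenclass`) and the torsion bounds `#(Kum_v ∩ ker 2^j) ≤ 2·4^j`,
`#(Kum_v ∩ ker 2^(j+1)) ≤ 2·4^(j+1)` (`natCard_kummer_inf_ker_le`). `j = 0` is g13's `lozenge_refill_of_regular_eigenclass`
up to the constant. Together with the cut inequality `#S'·#A² ≤ #S·#Kum_v`: the size of the new vertex is determined by
`#S`, `#A`, `#Kum_v = 4^k` up to a factor `2^(4j+4)` INDEPENDENT OF `k`. [cite: MazurRubin2004, Prop. 1.3.2, §4.1]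
[cite: Jetchev2008, Lemma 5.2, proof of Prop. 5.3] [cite: Howard2004HeegnerKolyvagin, Thm. 2.1.11] -/
theorem lozenge_refill_of_regular_eigenclass_upTo [NeZero (2 ^ k)]
    [Finite (geomTorsion (W.baseChange K) ((2 ^ k : ℕ) : ℤ))] {j : ℕ} (hjk : j ≤ k)
    {z : galoisCohomology ((W.baseChange K).torsionGaloisModule ((2 ^ k : ℕ) : ℤ)) 1}
    (hz : z ∈ SelmerStructure.selmerGroup (Function.update (selmerF W ((2 ^ k : ℕ) : ℤ) 𝒯 (placesDividing K c))
      (Sum.inr v : Place K) ((W.baseChange K).kummerSelmerStructure ((2 ^ k : ℕ) : ℤ) (Sum.inr v : Place K)) :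
      SelmerStructure ((W.baseChange K).torsionGaloisModule ((2 ^ k : ℕ) : ℤ))))
    (hzτ : conjAct W τ ((2 ^ k : ℕ) : ℤ) z = s • z)
    (hzord : addOrderOf (galoisCohomology.localization ((W.baseChange K).torsionGaloisModule ((2 ^ k : ℕ) : ℤ))
      (Sum.inr v : Place K) 1 z) = 2 ^ (k - j)) :
    Nat.card (SelmerStructure.selmerGroup (Function.update (selmerF W ((2 ^ k : ℕ) : ℤ) 𝒯 (placesDividing K c))
          (Sum.inr v : Place K) ((W.baseChange K).kummerSelmerStructure ((2 ^ k : ℕ) : ℤ) (Sum.inr v : Place K)) :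
          SelmerStructure ((W.baseChange K).torsionGaloisModule ((2 ^ k : ℕ) : ℤ)))) *
        Nat.card ((W.baseChange K).kummerSelmerStructure ((2 ^ k : ℕ) : ℤ) (Sum.inr v : Place K)) ≤
      2 ^ (4 * j + 4) *
        Nat.card ((SelmerStructure.selmerGroup (Function.update (selmerF W ((2 ^ k : ℕ) : ℤ) 𝒯 (placesDividing K c))
            (Sum.inr v : Place K) ((W.baseChange K).kummerSelmerStructure ((2 ^ k : ℕ) : ℤ) (Sum.inr v : Place K)) :
            SelmerStructure ((W.baseChange K).torsionGaloisModule ((2 ^ k : ℕ) : ℤ)))).map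
          (galoisCohomology.localization ((W.baseChange K).torsionGaloisModule ((2 ^ k : ℕ) : ℤ))
            (Sum.inr v : Place K) 1)) ^ 2 *
        Nat.card (selmerF W ((2 ^ k : ℕ) : ℤ) 𝒯 (placesDividing K c)).selmerGroup := by
  haveI : Finite (galoisCohomology ((((W.baseChange K).torsionGaloisModule ((2 ^ k : ℕ) : ℤ))).toLocal
      (Sum.inr v : Place K)) 1) := finite_galoisCohomology_one_toLocal _ v
  haveI : ∀ w : Place K, CompactSpace (absoluteGaloisGroup (Place.Completion w)) :=
    fun w ↦ absoluteGaloisGroup_compactSpace _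
  have hinv : Injective (inv (Sum.inr v)) := (hperf v).1.1
  have hvc : v ∈ placesDividing K c := mem_placesDividing_of_mem_primeFactors hc hℓc v hv
  obtain ⟨e₀, he₀, hcyc⟩ := hcyc_upTo_of_eigenclass W k hK hk c hkol hkM 𝒯 hℓc hreg v hv hτ1 hfix hs hjk hz hzτ hzord
  set 𝓛 := selmerF W ((2 ^ k : ℕ) : ℤ) 𝒯 (placesDividing K c) with h𝓛
  set loc := galoisCohomology.localization ((W.baseChange K).torsionGaloisModule ((2 ^ k : ℕ) : ℤ))
    (Sum.inr v : Place K) 1 with hloc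
  set Rel := SelmerStructure.selmerGroup (Function.update 𝓛 (Sum.inr v : Place K) ⊤ :
    SelmerStructure ((W.baseChange K).torsionGaloisModule ((2 ^ k : ℕ) : ℤ))) with hRel
  have hS : SelmerStructure.selmerGroup (Function.update 𝓛 (Sum.inr v : Place K)
        ((W.baseChange K).kummerSelmerStructure ((2 ^ k : ℕ) : ℤ) (Sum.inr v : Place K)) :
        SelmerStructure ((W.baseChange K).torsionGaloisModule ((2 ^ k : ℕ) : ℤ))) =
      Rel ⊓ ((W.baseChange K).kummerSelmerStructure ((2 ^ k : ℕ) : ℤ) (Sum.inr v : Place K)).comap loc :=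
    selmerGroup_update_eq_inf_comap W k 𝓛 v _
  have h𝓛v : 𝓛 (Sum.inr v) = 𝒯 (Sum.inr v) := by rw [h𝓛, selmerF_inr, if_pos hvc]
  have hS' : 𝓛.selmerGroup = Rel ⊓ (𝒯 (Sum.inr v)).comap loc := by
    have h := selmerGroup_update_eq_inf_comap W k 𝓛 v (𝒯 (Sum.inr v))
    have hupd : Function.update 𝓛 (Sum.inr v : Place K) (𝒯 (Sum.inr v)) = 𝓛 := by
      rw [← h𝓛v, Function.update_eq_self]
    rw [hupd] at h
    exact h
  rw [hS, hS']
  have hconst : 2 * 2 ^ (j + 1) * 2 ^ (j + 1) * (2 * 2 ^ j * 2 ^ j) = 2 ^ (4 * j + 4) := by ring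
  rw [← hconst]
  exact lozenge_refill_of_cyclic_upTo_f
    (invWeilPairing (W.baseChange K) (2 ^ k) e hμ hadd₁ hadd₂ hgal inv (Sum.inr v))
    (X11b.KummerPT.nsmul_galoisCohomology_toLocal_eq_zero (W.baseChange K) (2 ^ k) (Sum.inr v))
    (fun x y ↦ AdditiveKoly.LagrangianSwitchAtP.invWeilPairing_symm (W.baseChange K) (2 ^ k) e hμ hadd₁ hadd₂ hgal
      halt inv (Sum.inr v) x y)
    (kummer_inf_transverse_eq_bot_two W k hK hD ι hk c hc hkol hkM 𝒯 h𝒯 v hvc)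
    (kummer_sup_transverse_eq_top_two W k hK hD ι hk c hc hkol hkM 𝒯 h𝒯 v hvc)
    (fun x hx y hy ↦ invWeilPairing_eq_zero_of_mem (W.baseChange K) (2 ^ k) e hμ hadd₁ hadd₂ hgal halt inv
      (Sum.inr v) hx hy)
    (fun x hx y hy ↦ transverse_isotropic_two W k e hμ hadd₁ hadd₂ hgal halt hnondeg inv hK hD ι hk c hc hkol hkM 𝒯
      h𝒯 hperf v hvc hx hy)
    (invWeilPairing_injective_of_symm W k e hμ hadd₁ hadd₂ hgal halt hnondeg inv v hinv) loc Rel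
    (isotropic_map_localization_relaxed_selmerF W k e hμ hadd₁ hadd₂ hgal halt hnondeg inv hK hD ι hk c hc hkol hkM 𝒯
      h𝒯 hperf hvan v hvc)
    (natCard_map_localization_relaxed_selmerF_eq W k e hμ hadd₁ hadd₂ hgal halt hnondeg inv hK hD ι hk c hc hkol hkM
      𝒯 h𝒯 hperf hvan hcomp v hvc)
    j he₀ hcyc
    (natCard_kummer_inf_ker_le W k hK hk c hkol hkM hℓc hreg v hv hτ1 hfix (2 ^ j) (by positivity))
    (natCard_kummer_inf_ker_le W k hK hk c hkol hkM hℓc hreg v hv hτ1 hfix (2 ^ (j + 1)) (by positivity))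


end Summit.BirchSwinnertonDyer.BirchSwinnertonDyer.Theorems.KolyvaginAtTwo.RegularRefill

end
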